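/-
COR-CM (cell pub-hodgecm2 = stage 2 of the Hodge ladder), seat p1 gen 19 (prover-pub-hodgecm2-p1-g19-0, 2026-08-21),
count-neutral CLAIM RUNBOOK-SANITY (HOME/INBOX.md 2026-08-21T03:40:53Z).  Sanity lemmas for the §2 definition cards of
the ops review runbook `HOME/REVIEW-RUNBOOK.md` (`review-runbook/9.4`, generation 2026-08-21T03:33:07Z; targets
`hc_cm_of_PerLFace`, `hc_cm_closed`) that are on its ATTENTION LIST with «no sanity evidence»:
D56 `Universe.PeriodNV`, D62 `PicardCM.Var`, D121 `Model.cmEmb`, D174 `singularCochainCosimplicial.map`.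
Pattern of `Summits/BirchSwinnertonDyer/BSDPercentage/Runbook/*Sanity.lean`: statements about EXISTING declarations only
((a) agreement / computed values, (b) holds- and fails-instances); no definition of content, no named fact, no cited record;
theorems only (the D62 inhabitants are stated as `Nonempty` / `∃` theorems, no `def`, no `instance`).  The module is a LEAF meant for the probe's evidence scope
(`review_runbook.py … --also-import Summits.HodgeConjecture.CorCM.Runbook.CorCMSanity`); nothing in the tree imports it.
Wording of record (lead RULING AUDIT-WORDING-2): «HC_CM follows in the kernel from BallQuotientUniformised ∧ PerLFace(model
universe of record)»; nothing here changes `Interfaces.lean` / `ModelChain.lean` or the binder table.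
-/
import Summits.HodgeConjecture.CorCM.PerLNotPerLFace
import Summits.HodgeConjecture.CorCM.Geometry.PeriodFreeShadow
import Literature.AlgebraicTopology.SingularHomology.SingularCochains
import Mathlib.NumberTheory.Cyclotomic.PrimitiveRoots
import Mathlib.NumberTheory.NumberField.CMField
import Mathlib.RingTheory.Polynomial.Cyclotomic.Roots
import HarnessLib

/-!
# Runbook sanity lemmas — COR-CM cell (`pub-hodgecm2`), REVIEW-RUNBOOK §2 definition cards D56 · D62 · D121 · D174

* D62 `PicardCM.Var` (the small index type of the Picard–CM model universe): explicit inhabitants, a `Nonempty`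
  instance, computed dimensions.
* D121 `Model.cmEmb` (the complex embedding of a CM field chosen once by `Classical.arbitrary`): it is injective, it is
  the underlying map of the code isomorphism `Model.cmCodeEquiv K Φ : K ≃+* (Model.cmCode K Φ).E`, its range is the code
  field, and the code's CM type is `Φ` transported along it.
* D174 `singularCochainCosimplicial.map` (pull-back of singular cochains along a continuous map, levelwise): evaluation
  formula `(f^♯ φ)(σ) = φ (f ∘ σ)`, agreement with the cochain-complex map `singularCochainComplex.map` (Mathlib's
  `alternatingCofaceMapComplex` applied to it), identity and composition.
* D56 `Universe.PeriodNV` (the conclusion shape "some quadrilinear period is non-zero" of PerL Thm 4.4 / rfwf Thm 4.1):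
  FAILS for every datum on the CM-type universe `cmTypeUniverse` (its trace is zero; `Universe.not_periodNV_of_tr`,
  `CorCM/Geometry/PeriodFreeShadow.lean`), HOLDS on the PerL shadow `cmTypeUniverse.perLShadow` for every surface field
  of degree `24` or `48` and every `σ` in all four types (`Universe.perLShadow_periodNV`, `CorCM/Geometry/PerLShadow.lean`,
  with M13/M14 supplied by `cmTypeUniverse_fact_eigenLine` / `…_alphaLine`), and is therefore SATISFIABLE with no
  hypothesis at all: `exists_periodNV` exhibits the datum `L = K = ℚ(ζ₃₅)` (`[L:ℚ] = φ(35) = 24`), `ι₁ = Model.cmEmb L`,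
  a Landherr hermitian space, the CM type of distinguished embeddings and `σ` the distinguished embedding of the place
  of `ι₁`.  (On the INTENDED universe `Model.picardCMUniverse …` the statement is the open period theorem; nothing is
  said about it.)

D17 `PicardCM.IsBallUniformisation` is not treated here: its evidence of record is
`BallQuotient.isBallUniformisation_unif` (`CorCM/Geometry/BallQuotientUniformisedOf.lean`) and the discharge
`BallQuotient.ballQuotientUniformised_holds` of the runbook's hypothesis card C1 (`CorCM/Geometry/BallQuotientUniformisedHolds.lean`,
p246465).
-/

noncomputable section

open Module NumberField

namespace Summit.HodgeConjecture.CorCM.Runbook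

open Literature.NumberTheory.Automorphic (PicardCM.Var PicardCM.CMCode)
open Literature.AlgebraicGeometry.Motives (CMType)

/-! ### D62 `PicardCM.Var` — inhabitants and computed dimensions -/

/-- (b) the index type is inhabited: the projective line `ℙ¹` is a point of it. [folklore] -/
theorem nonempty_var : Nonempty PicardCM.Var := ⟨.proj 1⟩

/-- (b) every natural number is the dimension of some point of the index type (`ℙⁿ`). [folklore] -/
theorem exists_var_dim_eq (n : ℕ) : ∃ v : PicardCM.Var, v.dim = n := ⟨.proj n, rfl⟩

/-- (b) the CM abelian variety of the model universe indexed by `(K, Φ)` is the point `Var.cm (Model.cmCode K Φ)` of the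
index type (so every CM pair gives an inhabitant). [folklore] -/
theorem cm_cmCode_isVar (K : CMField) (Φ : CMType K) :
    ∃ v : PicardCM.Var, v = .cm (Model.cmCode K Φ) := ⟨_, rfl⟩

/-- (a) computed value: `dim ℙ¹ = 1`. [folklore] -/
theorem dim_proj_one : (PicardCM.Var.proj 1).dim = 1 := rfl

/-- (a) computed value: `dim (ℙ² × ℙ³) = 2 + 3 = 5` (dimension is additive on products). [folklore] -/
theorem dim_prod_proj_two_proj_three : (PicardCM.Var.prod (.proj 2) (.proj 3)).dim = 5 := rfl

/-- (a) computed value: the CM abelian variety `Var.cm (Model.cmCode K Φ)` has dimension `[K:ℚ]/2` (the code field is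
`≅ K`). [folklore] -/
theorem dim_cm_cmCode (K : CMField) (Φ : CMType K) :
    (PicardCM.Var.cm (Model.cmCode K Φ)).dim = finrank ℚ K / 2 := by
  rw [PicardCM.Var.dim_cm]
  change finrank ℚ (PicardCM.CMCode.ofCMType (Model.cmEmb K) Φ).E / 2 = _
  rw [PicardCM.CMCode.finrank_ofCMType_E]

/-- (b) distinct constructors give distinct points: `ℙ¹ ≠ ℙ² × ℙ³` in the index type. [folklore] -/
theorem proj_one_ne_prod : PicardCM.Var.proj 1 ≠ .prod (.proj 2) (.proj 3) := by
  simp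

/-! ### D121 `Model.cmEmb` — the chosen complex embedding of a CM field -/

/-- (a) the chosen embedding `Model.cmEmb K : K →+* ℂ` is injective (a ring map out of a field). [folklore] -/
theorem cmEmb_injective (K : CMField) : Function.Injective (Model.cmEmb K) :=
  (Model.cmEmb K).injective

/-- (a) agreement: the code isomorphism `Model.cmCodeEquiv K Φ : K ≃+* (Model.cmCode K Φ).E` IS `Model.cmEmb K` followed
by the inclusion of the code field into `ℂ`. [folklore] -/
theorem coe_cmCodeEquiv_apply (K : CMField) (Φ : CMType K) (x : K) :
    ((Model.cmCodeEquiv K Φ x : (Model.cmCode K Φ).E) : ℂ) = Model.cmEmb K x :=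
  RingHom.rangeRestrictFieldEquiv_apply_coe _ _

/-- (a) agreement: the code field of `(K, Φ)` is the range `(Model.cmEmb K)(K) ⊂ ℂ` of the chosen embedding. [folklore] -/
theorem cmCode_E_eq_fieldRange (K : CMField) (Φ : CMType K) :
    (Model.cmCode K Φ).E = (Model.cmEmb K).fieldRange := rfl

/-- (b) membership: a complex number lies in the code field iff it is a value of the chosen embedding. [folklore] -/
theorem mem_cmCode_E_iff (K : CMField) (Φ : CMType K) (z : ℂ) :
    z ∈ (Model.cmCode K Φ).E ↔ ∃ x : K, Model.cmEmb K x = z :=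
  RingHom.mem_fieldRange

/-- (b) in particular every value `Model.cmEmb K x` lies in the code field. [folklore] -/
theorem cmEmb_mem_cmCode_E (K : CMField) (Φ : CMType K) (x : K) : Model.cmEmb K x ∈ (Model.cmCode K Φ).E :=
  (mem_cmCode_E_iff K Φ _).2 ⟨x, rfl⟩

/-- (a) agreement: the CM type of the code is `Φ` transported along the chosen embedding — an embedding `σ` of the code
field is in the code's type iff `σ ∘ cmCodeEquiv ∈ Φ`. [folklore] -/
theorem mem_cmCode_Φ_iff (K : CMField) (Φ : CMType K) (σ : (Model.cmCode K Φ).E →+* ℂ) :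
    σ ∈ (Model.cmCode K Φ).Φ.1 ↔ σ.comp (Model.cmCodeEquiv K Φ).toRingHom ∈ Φ.1 :=
  Iff.rfl

/-- (b) the chosen embedding defines an infinite place of `K` whose distinguished embedding is `cmEmb K` or its
conjugate (so "the place of `cmEmb K`" is meaningful data). [folklore] -/
theorem embedding_mk_cmEmb (K : CMField) :
    (InfinitePlace.mk (Model.cmEmb K)).embedding = Model.cmEmb K ∨
      (InfinitePlace.mk (Model.cmEmb K)).embedding = ComplexEmbedding.conjugate (Model.cmEmb K) := by
  rcases InfinitePlace.embedding_mk_eq (Model.cmEmb K) with h | h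
  · exact Or.inl h
  · exact Or.inr h

/-! ### D174 `singularCochainCosimplicial.map` — evaluation, agreement with the cochain-complex map, functoriality -/

section Cochains

open CategoryTheory Opposite Simplicial Literature.AlgebraicTopology.SingularHomology

universe u v

variable (R : Type v) [CommRing R] (M : Type v) [AddCommGroup M] [_root_.Module R M]
variable {X Y Z : Type u} [TopologicalSpace X] [TopologicalSpace Y] [TopologicalSpace Z]

/-- (a) evaluation formula: in cosimplicial degree `⦋n⦌`, `(f^♯ φ)(σ) = φ (f ∘ σ)` — pull-back of a cochain is
precomposition with push-forward of simplices (Hatcher §3.1). [folklore] -/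
theorem singularCochainCosimplicial_map_app_apply (f : C(X, Y)) (n : ℕ)
    (φ : (singularCochainCosimplicial R M Y).obj ⦋n⦌) (σ : SingularSimplex X n) :
    (singularCochainCosimplicial.map R M f).app ⦋n⦌ φ σ = φ (σ.map f) :=
  rfl

/-- (a) agreement: the degree-`n` component of the cochain-complex map `singularCochainComplex.map R M f` (Mathlib's
`alternatingCofaceMapComplex` functor applied to the cosimplicial map) IS the `⦋n⦌`-component of
`singularCochainCosimplicial.map R M f`. [folklore] -/
theorem singularCochainComplex_map_f (f : C(X, Y)) (n : ℕ) :
    (singularCochainComplex.map R M f).f n = (singularCochainCosimplicial.map R M f).app ⦋n⦌ :=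
  rfl

/-- (a) computed value: pulling back along the identity map does nothing, componentwise. [folklore] -/
theorem singularCochainCosimplicial_map_id_app_apply (n : ℕ) (φ : (singularCochainCosimplicial R M X).obj ⦋n⦌) :
    (singularCochainCosimplicial.map R M (ContinuousMap.id X)).app ⦋n⦌ φ = φ := by
  funext σ
  rw [singularCochainCosimplicial_map_app_apply, SingularSimplex.map_id]

/-- (a) computed value: pull-back along a composite is the composite of the pull-backs in the opposite order,
componentwise (contravariance). [folklore] -/
theorem singularCochainCosimplicial_map_comp_app_apply (f : C(X, Y)) (g : C(Y, Z)) (n : ℕ)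
    (φ : (singularCochainCosimplicial R M Z).obj ⦋n⦌) :
    (singularCochainCosimplicial.map R M (g.comp f)).app ⦋n⦌ φ =
      (singularCochainCosimplicial.map R M f).app ⦋n⦌ ((singularCochainCosimplicial.map R M g).app ⦋n⦌ φ) := by
  funext σ
  rw [singularCochainCosimplicial_map_app_apply, singularCochainCosimplicial_map_app_apply,
    singularCochainCosimplicial_map_app_apply, SingularSimplex.map_comp]

/-- (a) functoriality: `𝟙^♯ = 𝟙` as a morphism of cosimplicial modules. [folklore] -/
theorem singularCochainCosimplicial_map_id :
    singularCochainCosimplicial.map R M (ContinuousMap.id X) = 𝟙 (singularCochainCosimplicial R M X) := by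
  ext d φ
  induction d using SimplexCategory.rec with
  | _ n =>
    rw [singularCochainCosimplicial_map_id_app_apply]
    rfl

/-- (a) functoriality: `(g ∘ f)^♯ = g^♯ ≫ f^♯` as morphisms of cosimplicial modules. [folklore] -/
theorem singularCochainCosimplicial_map_comp (f : C(X, Y)) (g : C(Y, Z)) :
    singularCochainCosimplicial.map R M (g.comp f) =
      singularCochainCosimplicial.map R M g ≫ singularCochainCosimplicial.map R M f := by
  ext d φ
  induction d using SimplexCategory.rec with
  | _ n =>
    rw [singularCochainCosimplicial_map_comp_app_apply]
    rfl

end Cochains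

/-! ### D56 `Universe.PeriodNV` — fails-instances, holds-instances, satisfiability -/

/-- (b) FAILS-instance: on the CM-type universe `cmTypeUniverse` (`CorCM/Model/CMTypeUniverse.lean`; its trace is `0`)
no period datum has a non-vanishing period. [folklore] -/
theorem not_periodNV_cmTypeUniverse {L : CMField} (ι₁ : L →+* ℂ) (V : HermSpace3 L ι₁) (K : CMField)
    (Ψ : Fin 4 → CMType K) (σ : K →+* ℂ) : ¬ cmTypeUniverse.PeriodNV ι₁ V K Ψ σ :=
  cmTypeUniverse.not_periodNV_of_tr (fun _ _ => rfl) ι₁ V K Ψ σ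

/-- (b) FAILS-instance on the shadow: over a surface field whose degree is NOT `24` or `48` the PerL shadow of the CM-type
universe has no non-vanishing period. [folklore] -/
theorem not_periodNV_perLShadow_cmTypeUniverse {L : CMField}
    (hL : ¬ (finrank ℚ L = 24 ∨ finrank ℚ L = 48)) (ι₁ : L →+* ℂ) (V : HermSpace3 L ι₁) (K : CMField)
    (Ψ : Fin 4 → CMType K) (σ : K →+* ℂ) : ¬ cmTypeUniverse.perLShadow.PeriodNV ι₁ V K Ψ σ :=
  cmTypeUniverse.perLShadow_not_periodNV hL ι₁ V K Ψ σ

/-- (b) HOLDS-instance, hypothesis-free in the universe: on the PerL shadow of the CM-type universe (M13/M14 are theorems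
there) every datum over a surface field of degree `24` or `48`, with `σ` in all four target types, has a non-vanishing
period. [folklore] -/
theorem periodNV_perLShadow_cmTypeUniverse {L : CMField} (hL : finrank ℚ L = 24 ∨ finrank ℚ L = 48)
    (ι₁ : L →+* ℂ) (V : HermSpace3 L ι₁) (K : CMField) (Ψ : Fin 4 → CMType K) (σ : K →+* ℂ)
    (hσ : ∀ i, σ ∈ (Ψ i).1) : cmTypeUniverse.perLShadow.PeriodNV ι₁ V K Ψ σ :=
  cmTypeUniverse.perLShadow_periodNV cmTypeUniverse_fact_eigenLine cmTypeUniverse_fact_alphaLine hL ι₁ V K Ψ σ hσ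

/-- `ℚ(ζ₃₅)` is a CM field (Mathlib: every cyclotomic extension `ℚ(ζₙ)/ℚ` with `n > 2` is CM). [folklore] -/
theorem isCMField_cyclotomicField_thirtyFive : IsCMField (CyclotomicField.{0} 35 ℚ) :=
  @IsCyclotomicExtension.Rat.isCMField _ _ _ {35} ⟨35, rfl, by norm_num⟩
    (CyclotomicField.instIsCyclotomicExtensionSingletonNatSetOfCharZero 35 ℚ)

/-- `[ℚ(ζ₃₅) : ℚ] = φ(35) = φ(5)·φ(7) = 24`. [folklore] -/
theorem finrank_cyclotomicField_thirtyFive : finrank ℚ (CyclotomicField.{0} 35 ℚ) = 24 := by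
  haveI : IsCyclotomicExtension {35} ℚ (CyclotomicField.{0} 35 ℚ) :=
    CyclotomicField.instIsCyclotomicExtensionSingletonNatSetOfCharZero 35 ℚ
  rw [IsCyclotomicExtension.finrank (n := 35) (K := ℚ) (CyclotomicField.{0} 35 ℚ)
    (Polynomial.cyclotomic.irreducible_rat (by norm_num))]
  rw [show (35 : ℕ) = 5 * 7 from rfl, Nat.totient_mul (by norm_num : Nat.Coprime 5 7),
    Nat.totient_prime (by norm_num : Nat.Prime 5), Nat.totient_prime (by norm_num : Nat.Prime 7)]

/-- (b) SATISFIABILITY of `Universe.PeriodNV`, no hypothesis: some universe carries a period datum with a non-vanishing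
quadrilinear period.  Witness: the PerL shadow of the CM-type universe; surface field `L = ℚ(ζ₃₅)` (CM, degree `24`) with
distinguished embedding `ι₁ := Model.cmEmb L`; a hermitian 3-space of signature `(2,1)` at `ι₁`, `(3,0)` elsewhere
(Landherr, `landherr_exists_proof`); targets `K = L` with all four types the CM type of distinguished embeddings; `σ` the
distinguished embedding of the place of `ι₁`. [folklore] -/
theorem exists_periodNV :
    ∃ (U : Universe) (L : CMField) (ι₁ : L →+* ℂ) (V : HermSpace3 L ι₁) (K : CMField) (Ψ : Fin 4 → CMType K)
      (σ : K →+* ℂ), U.PeriodNV ι₁ V K Ψ σ := by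
  haveI := isCMField_cyclotomicField_thirtyFive
  let L : CMField := ⟨CyclotomicField.{0} 35 ℚ⟩
  have hL : finrank ℚ L = 24 ∨ finrank ℚ L = 48 := Or.inl finrank_cyclotomicField_thirtyFive
  let ι₁ : L →+* ℂ := Model.cmEmb L
  obtain ⟨V⟩ := landherr_exists_proof L ι₁
  let Φ₀ : CMType L := ⟨Set.range fun w : InfinitePlace L => w.embedding, range_embedding_isCMType L⟩
  exact ⟨cmTypeUniverse.perLShadow, L, ι₁, V, L, fun _ => Φ₀, (InfinitePlace.mk ι₁).embedding,
    periodNV_perLShadow_cmTypeUniverse hL ι₁ V L (fun _ => Φ₀) _ fun _ => ⟨InfinitePlace.mk ι₁, rfl⟩⟩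

/-- (b) hence `Universe.PeriodNV` is a genuinely contingent predicate: it holds for some universe and datum and fails for
another (it is neither provable nor refutable from its shape alone). [folklore] -/
theorem periodNV_independent :
    (∃ (U : Universe) (L : CMField) (ι₁ : L →+* ℂ) (V : HermSpace3 L ι₁) (K : CMField) (Ψ : Fin 4 → CMType K)
        (σ : K →+* ℂ), U.PeriodNV ι₁ V K Ψ σ) ∧
      ∃ (U : Universe), ∀ (L : CMField) (ι₁ : L →+* ℂ) (V : HermSpace3 L ι₁) (K : CMField) (Ψ : Fin 4 → CMType K)
        (σ : K →+* ℂ), ¬ U.PeriodNV ι₁ V K Ψ σ :=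
  ⟨exists_periodNV, cmTypeUniverse, fun _ ι₁ V K Ψ σ => not_periodNV_cmTypeUniverse ι₁ V K Ψ σ⟩

end Summit.HodgeConjecture.CorCM.Runbook

end
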